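import Literature.MathematicalPhysics.QuantumFieldTheory.Balaban1983to89.Node00.HistoryTermDatum214LocalGrowthAnalytic
import Literature.MathematicalPhysics.QuantumFieldTheory.Balaban1983to89.Node00.HistoryAdmissibleClass
import Literature.MathematicalPhysics.QuantumFieldTheory.Balaban1983to89.B13Term214

/-!
# BalabanUVNodes ∕ node N22 = NE9 — THE RELATIVE-DISC CENTRED ROAD OVER THE ADMISSIBLE CLASS, MODULE J17-D: THE LOCATED INPUTS OF ONE SLICE, LEMMA-2-SENTENCE EDITION ON AN OPEN
# THICKENING (`SliceInputsL2U`: J12-D `SliceInputsLGU` with its twenty-eight LEADING-PART Taylor fields REPLACED by [II] Lemma 2's sentence PER CONFIGURATION — complex potentials,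
# ONE radius, per-domain sup bounds uniform on the thickening and on the admissible class, the third-order onset, `Y`-locality — so that the cubic Wilson part and the zero-field
# differential of the older terms VARY WITH THE CONFIGURATION, as [I] (2.8) and [II] (1.41) have it)

Cell `pub-ymgap`, HUMAN RULING D-0062 (Track A), R134 ACCELERATION re-seat `pub-ymgap-dag-n22-c` (strategy s1), generation 10, file J17-D (DEFINITION LANE: one `structure`, no theorem, no
instance ∕ notation).  Imports node00-def-W1 W1-12b `Node00/HistoryTermDatum214LocalGrowthAnalytic` (`TermDatum214.ComplexWilson ∕ ComplexOlder ∕ Lemma2Inputs` vocabulary; through it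
W1-7 ∕ W1-11 ∕ W1-12 and dag-n10-c module 48 `B13Lemma2LeadingParts`: `ofRealVec`, `cubicPart`, `linPart`, `wilson_letters`, `older_letters`), W1-13 `Node00/HistoryAdmissibleClass`,
`B13Term214`.  Namespace `YMDAG.N22.W1` (this seat's consumer-side namespace; the record bundles HYPOTHESES of this seat's readings — NOT a W1 object).  `--kind definition --supports` K3⁷
`SpineGivenEndpointR13SepCoPH` (stmt-QuantumFields-20544).

WHY — THE LOCATED FINDING THIS FILE REPAIRS (author's own, A6-class, bus «LOCATED-LEADING-PARTS-N22» 2026-08-27).  Module J12-D `SliceInputsLGU` (the uniform ∕ primitive located-input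
record on an open thickening `W ⊇ U^c_{k′+1}(X, α₀, α₁)` of the table) types the CUBIC PART of the Wilson remainder `𝒲₃ : 𝐃om → (Λ → ℝ) → ℂ` and the ZERO-FIELD DIFFERENTIAL of the
older-terms potential `D𝒪 : OlderTerms → 𝐃om → (Λ → ℝ) → ℂ` WITHOUT the configuration argument, while their Taylor laws `h2 : ∀ ξ ∈ W, ‖𝒲(ξ;Y,A) − 𝒲₃(Y,A)‖ ≤ c₄(Y)‖A‖⁴` and
`h5 : ∀ old, ∀ ξ ∈ W, ‖𝒪(old,ξ;Y,A) − 𝒪(old,ξ;Y,0) − D𝒪(old,Y,A)‖ ≤ c₂(Y)‖A‖²` are asked at EVERY configuration of `W`.  Consequence (module J17-W §1, kernel): any inhabitant has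
`‖𝒲(ξ;Y,A) − 𝒲(ξ′;Y,A)‖ ≤ 2c₄(Y)‖A‖⁴` on the ρ-ball for all `ξ, ξ′ ∈ W` — under Lemma 2's analyticity the cubic part of `A ↦ 𝒲(ξ;Y,A)` (and likewise the differential of
`A ↦ 𝒪(old,ξ;Y,A)` at the zero field) is CONSTANT IN THE CONFIGURATION on `W`.  Print says otherwise: [I] (2.8) p. 266 «Denoting terms of at least third order in H₁B′ by V(H₁B′)» with
`H₁ = H_{1,k}` and `Δ₁` built on the background `U_k` OF THE CONFIGURATION ((2.6)–(2.7)), and [II] (1.41) p. 11 (`𝐕″_k(Y, U, J, B)` reads the older terms at the configuration moved by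
the fluctuation) — both leading parts DEPEND on `ξ`; W1-11 types `𝒲 : … → CPair P 𝔸 → 𝐃om → (Λ → ℝ) → ℂ` accordingly, and J10-D's PER-CONFIGURATION record `SliceInputsLG` carries
`𝒲₃`, `D𝒪` per record, i.e. per configuration (consistent).  ORIGIN: mechanical — J12-D's field list was generated from J10-D's by `φ ↦ ∀ ξ ∈ W` on the fields whose declaration
mentions `φ`; the six leading-part fields do not.  Nothing landed is false (J12-D ∕ J12-M ∕ J12-K ∕ J13 ∕ J15 ∕ J16 are valid as typed; J13's joint witness has vanishing potentials and
does not see the restriction); the defect is an OVER-RESTRICTION OF THE RECORD TYPE relative to the datum of record.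

WHAT — THE REPAIR, IN LEMMA 2's OWN CURRENCY.  Rather than merely indexing `𝒲₃`, `D𝒪` by `ξ`, this record asks PRINT'S SENTENCE from which every leading-part letter follows
(node00-def-W1 W1-12b typed it per `(old, φ)` as `TermDatum214.Lemma2Inputs` with the faces `h1_of ∕ h1loc_of ∕ h2_of ∕ h3 ∕ cubicPart_smul ∕ measurable_cubicPart ∕ h0 ∕ h4_of ∕ h5_of ∕
h6 ∕ linPart_smul ∕ measurable_linPart`; dag-n10-c module 48 `B13Lemma2LeadingParts.wilson_letters ∕ older_letters ∕ loc_of_cubic_of_local ∕ consts_nonneg` are the kernels): complex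
potentials `Wc : 𝔇.ComplexWilson`, `Oc : 𝔇.ComplexOlder` whose REAL SLICES at every `ξ ∈ W` (every admissible `old`) are the law's `𝒲 Z t ξ Y`, `𝒪 Z t old ξ Y` (`h𝒲re ∕ h𝒪re`);
ONE radius `RA` with `ρ < RA` ([I] (2.9): the boxes' threshold `ε₁` inside the analyticity ball `a₁e^{−16κ₁}`); per-domain sup bounds `M𝒲(Y)` ((1.39)) and `M𝒪(Y)` ((1.36)) UNIFORM on `W`
and on the admissible class (print: constants of (d, L, M, α′₀, α′₁) and of (1.18)'s letters only), signed on `𝐃`; complex-differentiability and the sup bounds on `ball 0 RA`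
(`hWd hWM hOd hOM`); the third-order onset `BeginsAt (Wc Z t ξ Y) 3` ([I] (2.8); `hWB`); `Y`-locality of `𝒲(ξ;Y,·)` through the bond supports `S Y` ((1.34) «restricted to the interior
of Y»; `hlocY𝒲`) with `S Y ⊆ S₀` (`hSS₀`, (2.2)–(2.3)).  REMOVED (derived by module J17-M at each configuration, with module 48's constants `c₃ = c₃′ = M𝒲∕RA³`, `c₄ = 2M𝒲∕RA⁴`,
`c₀ = M𝒪`, `c₁ = c₁′ = 2M𝒪∕RA`, `c₂ = 4M𝒪∕RA²`, leading parts `cubicPart (Wc Z t ξ Y)`, `linPart (Oc Z t old ξ Y)` — CONFIGURATION-DEPENDENT): `c₀ c₃ c₃′ c₄ c₁ c₁′ c₂`, `hc₃ hc₃′ hc₄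
hc₁ hc₁′ hc₂`, `𝒲₃ h𝒲₃m h𝒲₃ h1 h1loc h2 h3`, `D𝒪 hD𝒪m hD𝒪 h0 h4 h5 h6`, `hloc𝒲` (from `hlocY𝒲` + `hSS₀`).  RESTATED at the derived letters: the (2.19) profile `hdecay` and the
closures `hw′ hwc hw₀` (`ha′ hac` carry no leading letter and are verbatim).  VERBATIM from J12-D (field list GENERATED from the tree's J12-D by `gen/build_sliceL2U.py`): the thickening,
regions, boxes at `s₀` with (2.22), NODE A's kernel letters ∕ σ-laws ∕ primitive φ-laws `hAd hGd`, rates, primed letters, every numeric of the holomorphy half and of the box ∕ large-field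
blocks, `ρ hρ h𝒲m h𝒲d`, the τ-radii `R hR hUτR`, `S cubeOf hS`, `Cp κp hCp hκp`, `S₀ hbox`, `δ hδ`, the older-terms qualitative laws `h𝒪m h𝒪d hloc𝒪 hOhol` (module J15 supplies them
from a W1-17 reading VERBATIM), `ha′ hac`.  Module J17-M `SliceInputsL2U.nonempty_sliceInputsLG_of_lemma2` turns one such record into J10-D's `SliceInputsLG` AT EVERY `φ ∈ W`; module
J17-K re-runs the knit J10c over it (superseding J12-K as the s1 line's end state in primitive currency); module J16's kernel block and J15's older block serve this record by type.

HONEST FRAMING.  A LIST OF HYPOTHESES as a type — nothing asserted, nothing of Bałaban's constructed; an inhabitant at the datum of record (Lemma 2's construction (1.33)–(1.43) from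
def-B13's kernels with the profile and cube-location, NODE A's kernel letters, N09's boxes) is NODE A's ∕ N09's ∕ N10's ∕ def-W1's business; the thickening `W` is the producer's to name
(print's enlarged constants α′₀, α′₁); count-neutral; N22 NOT discharged (typed 28∕28 · discharged 5∕27 UNCHANGED); one finite four-torus programme at fixed ε — NOT infinite volume, NOT
OS on ℝ⁴, NOT a mass gap, NOT Clay.  SCOPE (inherited from W1-11 ∕ W1-12 ∕ W1-12b; ref-H WATCH-239): the sup-ball `‖A‖ ≤ ρ` inside the analyticity ball and the box-support law are the
OPTION-1 reading of [I] p. 266 (threshold `ε₁` on the UNSCALED field).  A6 (standing rule №189 ∕ №193): an in-tree inhabitant of this record type (W1-15's degenerate datum, `W := univ`,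
vanishing potentials: `Wc = Oc = 0`, `M𝒲 = M𝒪 = 0`, `RA = ρ + 1`) is OWED in the sibling file `…SliceInputsL2UWitness` (module J17-W); until it lands this record is «A6-UNCHECKED».
0 `sorry`, standard axioms.

References (TYPES only): [II] = [Balaban1988RG2Cluster] (1.5) p. 3, (1.26) p. 8, Lemma 1 (1.33)–(1.36) p. 9, (1.38)–(1.39) p. 10, Lemma 2 (1.41)–(1.43) p. 11, (2.2)–(2.3) p. 12,
(2.14)–(2.26) pp. 15–17; [I] = [Balaban1987RG1] §1 p. 263, (2.6)–(2.13) pp. 266–268.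
-/

noncomputable section

namespace YMDAG.N22.W1

open Set Metric Matrix
open scoped BigOperators
open Literature.MathematicalPhysics.QuantumFieldTheory.Balaban1983to89
open Literature.MathematicalPhysics.QuantumFieldTheory.Balaban1983to89.TreeLengthTorus (TPt TDom tsys torusTreeLen)
open Literature.MathematicalPhysics.QuantumFieldTheory.Balaban1983to89.B13Bound143 (invTau)
open Literature.MathematicalPhysics.QuantumFieldTheory.Balaban1983to89.B9Thm37GlueTorus (tdist1)
open Literature.MathematicalPhysics.QuantumFieldTheory.Balaban1983to89.B5TorusCover (UT)
open Literature.MathematicalPhysics.QuantumFieldTheory.Balaban1983to89.Step (SFConsts)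
open Literature.MathematicalPhysics.QuantumFieldTheory.Balaban1983to89.Node00.Sect2 (domSys domCount CPair spaceI domSites Setting Residual)
open Literature.MathematicalPhysics.QuantumFieldTheory.Balaban1983to89.Node00.W1
open Literature.MathematicalPhysics.QuantumFieldTheory.Balaban1983to89.B13Term214 (term214 core214 F214)
open Literature.MathematicalPhysics.QuantumFieldTheory.Balaban1983to89.B12TreeDecay (K₀ kappa₀)
open Literature.MathematicalPhysics.QuantumFieldTheory.Balaban1983to89.B13ExpansionOrder (BeginsAt)
open Literature.MathematicalPhysics.QuantumFieldTheory.Balaban1983to89.B13Lemma2LeadingParts (ofRealVec)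

variable {c₀ : B13.Consts} {P : Params} {𝔸 : Type*} [NormedRing 𝔸] [NormedAlgebra ℂ 𝔸] [CompleteSpace 𝔸] {M k L : ℕ} [NeZero L] (𝔇 : TermDatum214 c₀ P 𝔸 M k L)
  (χu χcu : (Z : (domSys P M (k + 1)).Dom) → (t : TermLabel P M k L) → ((𝔇.𝒦 Z t).Λ → ℝ) → ℝ)
  (𝒲 : (Z : (domSys P M (k + 1)).Dom) → (t : TermLabel P M k L) → CPair P 𝔸 → TDom P.d (L * domCount P M (k + 1)) → ((𝔇.𝒦 Z t).Λ → ℝ) → ℂ)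
  (𝒪 : (Z : (domSys P M (k + 1)).Dom) → (t : TermLabel P M k L) → OlderTerms P 𝔸 M k → CPair P 𝔸 → TDom P.d (L * domCount P M (k + 1)) →
    ((𝔇.𝒦 Z t).Λ → ℝ) → ℂ)

open Classical in
/-- **THE LOCATED INPUTS OF ONE SLICE — LEMMA-2-SENTENCE EDITION, UNIFORM ON AN OPEN THICKENING** — for the window-dilated members of base point `s₀` of the term `(Z, t)` of the (2.14)
datum `𝔇` at EVERY configuration of an OPEN set `W ⊆ Φ`: module J12-D's record `SliceInputsLGU` (thickening, regions, boxes at `s₀` with (2.22), NODE A's kernel letters ∕ σ-laws ∕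
primitive φ-laws, rates, primed letters, numerics, the box ∕ large-field blocks, the τ-radii, bond supports, cube-location, the (2.19) profile, the box-support law, the qualitative laws
of the potentials `h𝒲m h𝒲d h𝒪m h𝒪d hloc𝒪 hOhol`, the closures) with its twenty-eight LEADING-PART Taylor fields — the letters `c₀ c₃ c₃′ c₄ c₁ c₁′ c₂` and their signs, the cubic
part `𝒲₃` with `h𝒲₃m h𝒲₃ h1 h1loc h2 h3`, the zero-field differential `D𝒪` with `hD𝒪m hD𝒪 h0 h4 h5 h6`, and `hloc𝒲` — REPLACED by [II] LEMMA 2's SENTENCE PER CONFIGURATION in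
node00-def-W1 W1-12b's vocabulary: complex potentials `Wc : 𝔇.ComplexWilson`, `Oc : 𝔇.ComplexOlder` whose real slices at every `ξ ∈ W` (every admissible `old`) are the law's
`𝒲(ξ; Y, ·)`, `𝒪(old, ξ; Y, ·)`, ONE radius `RA > ρ`, per-domain sup bounds `M𝒲(Y)` ((1.39)), `M𝒪(Y)` ((1.36)) UNIFORM on `W` and on the admissible class, complex-differentiability on
the sup-ball, the third-order onset `BeginsAt (Wc Z t ξ Y) 3` ([I] (2.8)), `Y`-locality through `S Y` with `S Y ⊆ S₀`; the closures `hw′ hwc hw₀` and the profile `hdecay` restated at the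
derived letters `c₃ = c₃′ = M𝒲∕RA³`, `c₄ = 2M𝒲∕RA⁴`, `c₀ = M𝒪`, `c₁ = c₁′ = 2M𝒪∕RA`, `c₂ = 4M𝒪∕RA²` (module 48's constants).  WHY: J12-D typed `𝒲₃`, `D𝒪` WITHOUT the configuration
argument while asking their Taylor laws at every `ξ ∈ W` — forcing the leading parts to be configuration-free on `W`, which Bałaban's `V(H₁(U_k)B′)` and `𝐕″(U(φ))` are not; here the
leading parts are `cubicPart (Wc Z t ξ Y)`, `linPart (Oc Z t old ξ Y)` and VARY WITH `ξ` (module J17-M derives J10-D's per-configuration record at each `φ ∈ W`).  Nothing asserted.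
[cite: Balaban1988RG2Cluster, Lemma 1 (1.33)-(1.36) p.9, (1.38)-(1.39) p.10, Lemma 2 (1.41)-(1.43) p.11, (2.2)-(2.3) p.12, (2.14)-(2.26) pp.15-17 (p.15 ll.19-20), (1.5) p.3, (1.26) p.8; Balaban1987RG1, §1 p.263, (2.8)-(2.13) pp.266-268] -/
structure SliceInputsL2U (c : B13.Consts) {G : Type*} [GaugeGroup G] (Sg : Setting 𝔸 G) (Rz : Residual P 𝔸) (cs : SFConsts) (E₀ κE : ℝ)
    (Z : (domSys P M (k + 1)).Dom) (t : TermLabel P M k L) (W : Set (CPair P 𝔸)) (s₀ a a₅ ρb Mv : ℝ) where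
  /-- located letter `Uσ` -/
  Uσ : Set ℂ
  /-- located letter `Uτ` -/
  Uτ : TDom P.d (L * domCount P M (k + 1)) → Set ℂ
  /-- located letter `γ₂` -/
  γ₂ : ℝ
  /-- located letter `rP` -/
  rP : ℝ
  /-- located letter `qP` -/
  qP : ((𝔇.𝒦 Z t).Λ → ℝ) → ℝ
  /-- located letter `kap` -/
  kap : ℝ
  /-- located letter `kap'` -/
  kap' : ℝ
  /-- located letter `kap''` -/
  kap'' : ℝ
  /-- located letter `θ` -/
  θ : ℝ
  /-- located letter `θE` -/
  θE : ℝ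
  /-- located letter `θΓ` -/
  θΓ : ℝ
  /-- located letter `θC` -/
  θC : ℝ
  /-- located letter `KG` -/
  KG : ℝ
  /-- located letter `KΓ` -/
  KΓ : ℝ
  /-- located letter `KCs` -/
  KCs : ℝ
  /-- located letter `K₀` -/
  K₀ : ℝ
  /-- located letter `KE` -/
  KE : ℝ
  /-- located letter `KG'` -/
  KG' : ℝ
  /-- located letter `KCs'` -/
  KCs' : ℝ
  /-- located letter `θΓ'` -/
  θΓ' : ℝ
  /-- located letter `θC'` -/
  θC' : ℝ
  /-- located letter `θE'` -/
  θE' : ℝ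
  /-- located letter `a'` -/
  a' : ℝ
  /-- located letter `w'` -/
  w' : ℝ
  /-- located letter `cE` -/
  cE : ℝ
  /-- located letter `g` -/
  g : ℝ
  /-- located letter `Rb` (the box radius of the unscaled-field boxes at `s₀`: `χχᶜ = 1` on `⟨B′,B′⟩ < Rb²`) -/
  Rb : ℝ
  /-- located letter `κ` -/
  κ : ℝ
  /-- located letter `a₀` -/
  a₀ : ℝ
  /-- located letter `w₀` -/
  w₀ : ℝ
  /-- located letter `T` -/
  T : ℝ
  /-- located letter `α₀` -/
  α₀ : ℝ
  /-- located letter `r₁` -/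
  r₁ : ℝ
  /-- located letter `TP` -/
  TP : ℝ
  /-- located letter `ac` -/
  ac : ℝ
  /-- located letter `wc` -/
  wc : ℝ
  -- ═════════ THE THICKENING ([II] p. 15: «analytic functions on the space of configurations … with constants α′₀, α′₁ much bigger than α₀, α₁»; the table of record is NOT open in Φ — dag-n18-c file 11) ═════════
  /-- located input `hW`: the set `W` of configurations carrying the letters and laws is OPEN in `Φ = Sect2.CPair P 𝔸` -/
  hW : IsOpen W
  /-- located input `hpos` (see the module docstring) -/
  hpos : ∀ Y : TDom P.d (L * domCount P M (k + 1)), 0 < invTau c ((tsys P.d (L * domCount P M (k + 1))).dj Y)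
  /-- located input `hhalf` (see the module docstring) -/
  hhalf : ∀ Y : TDom P.d (L * domCount P M (k + 1)), invTau c ((tsys P.d (L * domCount P M (k + 1))).dj Y) ≤ 1 / 2
  /-- located input `hUσ` (see the module docstring) -/
  hUσ : IsOpen Uσ
  /-- located input `hUτ` (see the module docstring) -/
  hUτ : ∀ Y, IsOpen (Uτ Y)
  /-- located input `hUexp` (see the module docstring) -/
  hUexp : closedBall (0 : ℂ) (Real.exp c.κ₁) ⊆ Uσ
  /-- located input `hUtau` (see the module docstring) -/
  hUtau : ∀ Y : TDom P.d (L * domCount P M (k + 1)), closedBall (0 : ℂ) ((invTau c ((tsys P.d (L * domCount P M (k + 1))).dj Y))⁻¹) ⊆ Uτ Y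
  /-- located input `hr` (see the module docstring) -/
  hr : 0 < 𝔇.r
  /-- located input `hr'` (see the module docstring) -/
  hr' : 𝔇.r ≤ Real.exp c.κ₁ - 1
  /-- located input `hsubτ` (see the module docstring) -/
  hsubτ : ∀ Y, ∀ x ∈ Set.uIcc (0 : ℝ) 1, closedBall (x : ℂ) 𝔇.r ⊆ Uτ Y
  /-- located input `hχ0` (see the module docstring) -/
  hχ0 : ∀ B, 0 ≤ χu Z t (s₀ • B)
  /-- located input `hχc0` (see the module docstring) -/
  hχc0 : ∀ B, 0 ≤ χcu Z t (s₀ • B)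
  /-- located input `hχm` (see the module docstring) -/
  hχm : Measurable fun B : ((𝔇.𝒦 Z t).Λ) → ℝ => χu Z t (s₀ • B)
  /-- located input `hχcm` (see the module docstring) -/
  hχcm : Measurable fun B : ((𝔇.𝒦 Z t).Λ) → ℝ => χcu Z t (s₀ • B)
  /-- located input `h222` (see the module docstring) -/
  h222 : ∀ B, χu Z t (s₀ • B) * χcu Z t (s₀ • B) ≤ Real.exp (-(γ₂ / 2 * rP ^ 2 * (t.2.card : ℕ)) + γ₂ / 2 * qP B)
  /-- located input `hγ₂` (see the module docstring) -/
  hγ₂ : 0 ≤ γ₂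
  /-- located input `hqP` (see the module docstring) -/
  hqP : ∀ B, qP B ≤ B ⬝ᵥ B
  /-- located input `hAhol` (see the module docstring) — asked at EVERY configuration `ξ ∈ W` -/
  hAhol : ∀ ξ ∈ W, ∀ i j, DifferentiableOn ℂ (fun σ => 𝔇.A Z t ξ σ i j) {σ | ∀ j, σ j ∈ Uσ}
  /-- located input `hGhol` (see the module docstring) — asked at EVERY configuration `ξ ∈ W` -/
  hGhol : ∀ ξ ∈ W, ∀ i j, DifferentiableOn ℂ (fun σ => (𝔇.𝒦 Z t).G2 σ (𝔇.uOf Z t ξ) i j) {σ | ∀ j, σ j ∈ Uσ}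
  /-- located input `hAd` — PRIMITIVE φ-LAW of the precision kernel ((1.5) p. 3 read through `uOf`, p. 15 «U = U′U»): at each `σ` of the open polydisc, `ξ ↦ A(ξ, σ)` is entrywise complex differentiable on `W` -/
  hAd : ∀ σ : TPt P.d (domCount P M (k + 1)) → ℂ, (∀ j, σ j ∈ Uσ) → ∀ i j, DifferentiableOn ℂ (fun ξ : CPair P 𝔸 => 𝔇.A Z t ξ σ i j) W
  /-- located input `hGd` — PRIMITIVE φ-LAW of the Γ-kernel ((1.5) p. 3): at each `σ` of the open polydisc, `ξ ↦ G(σ, uOf ξ)` is entrywise complex differentiable on `W` -/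
  hGd : ∀ σ : TPt P.d (domCount P M (k + 1)) → ℂ, (∀ j, σ j ∈ Uσ) → ∀ i j, DifferentiableOn ℂ (fun ξ : CPair P 𝔸 => (𝔇.𝒦 Z t).G2 σ (𝔇.uOf Z t ξ) i j) W
  /-- located input `hAs` (see the module docstring) — asked at EVERY configuration `ξ ∈ W` -/
  hAs : ∀ ξ ∈ W, ∀ σ : TPt P.d (domCount P M (k + 1)) → ℂ, (∀ j, σ j ∈ Uσ) → (𝔇.A Z t ξ σ).IsSymm
  /-- located input `hfibN` (see the module docstring) -/
  hfibN : ∀ x : UT 𝔇.Nf, (Finset.univ.filter fun j => (𝔇.𝒦 Z t).locN j = x).card ≤ (𝔇.𝒦 Z t).m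
  /-- located input `hkap''` (see the module docstring) -/
  hkap'' : 0 < kap''
  /-- located input `hk1` (rate order) -/
  hk1 : kap'' < kap'
  /-- located input `hk2` (rate order) -/
  hk2 : kap' < kap
  /-- located input `hθE` (see the module docstring) -/
  hθE : 0 ≤ θE
  /-- located input `hθΓ` (see the module docstring) -/
  hθΓ : 0 ≤ θΓ
  /-- located input `hθC` (see the module docstring) -/
  hθC : 0 ≤ θC
  /-- located input `hKG` (see the module docstring) -/
  hKG : 0 ≤ KG
  /-- located input `hKΓ` (see the module docstring) -/
  hKΓ : 0 ≤ KΓ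
  /-- located input `hKCs` (see the module docstring) -/
  hKCs : 0 ≤ KCs
  /-- located input `hK₀` (see the module docstring) -/
  hK₀ : 0 ≤ K₀
  /-- located input `hKE` (see the module docstring) -/
  hKE : 0 ≤ KE
  /-- located input `hG` (see the module docstring) — asked at EVERY configuration `ξ ∈ W` -/
  hG : ∀ ξ ∈ W, ∀ σ : TPt P.d (domCount P M (k + 1)) → ℂ, (∀ j, σ j ∈ Uσ) → ∀ b j, ‖(𝔇.𝒦 Z t).G2 σ (𝔇.uOf Z t ξ) b j‖ ≤ KG * Real.exp (-(kap * tdist1 𝔇.Nf ((𝔇.𝒦 Z t).locΛ b) ((𝔇.𝒦 Z t).locN j)))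
  /-- located input `hΓ₀` (see the module docstring) -/
  hΓ₀ : ∀ b j, ‖(𝔇.𝒦 Z t).Γ₀ b j‖ ≤ KΓ * Real.exp (-(kap * tdist1 𝔇.Nf ((𝔇.𝒦 Z t).locΛ b) ((𝔇.𝒦 Z t).locN j)))
  /-- located input `hCs` (see the module docstring) — asked at EVERY configuration `ξ ∈ W` -/
  hCs : ∀ ξ ∈ W, ∀ σ : TPt P.d (domCount P M (k + 1)) → ℂ, (∀ j, σ j ∈ Uσ) → ∀ b b', ‖(𝔇.A Z t ξ σ)⁻¹ b b'‖ ≤ KCs * Real.exp (-(kap * tdist1 𝔇.Nf ((𝔇.𝒦 Z t).locΛ b) ((𝔇.𝒦 Z t).locΛ b')))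
  /-- located input `hC216` (see the module docstring) -/
  hC216 : ∀ b b', ‖(𝔇.𝒦 Z t).C b b'‖ ≤ K₀ * Real.exp (-(kap * tdist1 𝔇.Nf ((𝔇.𝒦 Z t).locΛ b) ((𝔇.𝒦 Z t).locΛ b')))
  /-- located input `hCE` (see the module docstring) -/
  hCE : ∀ b b', ‖((𝔇.𝒦 Z t).C⁻¹.map (algebraMap ℝ ℂ)) b b'‖ ≤ KE * Real.exp (-(kap * tdist1 𝔇.Nf ((𝔇.𝒦 Z t).locΛ b) ((𝔇.𝒦 Z t).locΛ b')))
  /-- located input `hdΓ` (see the module docstring) — asked at EVERY configuration `ξ ∈ W` -/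
  hdΓ : ∀ ξ ∈ W, ∀ σ : TPt P.d (domCount P M (k + 1)) → ℂ, (∀ j, σ j ∈ Uσ) → ∀ b j, ‖((𝔇.𝒦 Z t).G2 σ (𝔇.uOf Z t ξ) - (𝔇.𝒦 Z t).Γ₀.map (algebraMap ℝ ℂ)) b j‖ ≤ θΓ * Real.exp (-(kap * tdist1 𝔇.Nf ((𝔇.𝒦 Z t).locΛ b) ((𝔇.𝒦 Z t).locN j)))
  /-- located input `hdC` (see the module docstring) — asked at EVERY configuration `ξ ∈ W` -/
  hdC : ∀ ξ ∈ W, ∀ σ : TPt P.d (domCount P M (k + 1)) → ℂ, (∀ j, σ j ∈ Uσ) → ∀ b b', ‖((𝔇.A Z t ξ σ)⁻¹ - (𝔇.𝒦 Z t).C.map (algebraMap ℝ ℂ)) b b'‖ ≤ θC * Real.exp (-(kap * tdist1 𝔇.Nf ((𝔇.𝒦 Z t).locΛ b) ((𝔇.𝒦 Z t).locΛ b')))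
  /-- located input `hdE` (see the module docstring) — asked at EVERY configuration `ξ ∈ W` -/
  hdE : ∀ ξ ∈ W, ∀ σ : TPt P.d (domCount P M (k + 1)) → ℂ, (∀ j, σ j ∈ Uσ) → ∀ b b', ‖(𝔇.A Z t ξ σ - (𝔇.𝒦 Z t).C⁻¹.map (algebraMap ℝ ℂ)) b b'‖ ≤ θE * Real.exp (-(kap * tdist1 𝔇.Nf ((𝔇.𝒦 Z t).locΛ b) ((𝔇.𝒦 Z t).locΛ b')))
  /-- located input `hKG'` (see the module docstring) -/
  hKG' : (1 + ρb) * KG ≤ KG'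
  /-- located input `hKCs'` (see the module docstring) -/
  hKCs' : ((1 - ρb) ^ 2)⁻¹ * KCs ≤ KCs'
  /-- located input `hθΓ'` (see the module docstring) -/
  hθΓ' : θΓ + ρb * KG ≤ θΓ'
  /-- located input `hθC'` (see the module docstring) -/
  hθC' : θC + ρb * (2 + ρb) * ((1 - ρb) ^ 2)⁻¹ * KCs ≤ θC'
  /-- located input `hθE'` (see the module docstring) -/
  hθE' : θE + ρb * (2 + ρb) * (θE + KE) ≤ θE'
  /-- located input `hθEle` (see the module docstring) -/
  hθEle : θE' ≤ θ
  /-- located input `hθΓle` (see the module docstring) -/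
  hθΓle : θΓ' ≤ θ
  /-- located input `hθR1le` (see the module docstring) -/
  hθR1le : ((𝔇.𝒦 Z t).m * (1 + 2 / (kap - kap')) ^ 𝔇.ν) * ((𝔇.𝒦 Z t).m * (1 + 2 / (kap' - kap'')) ^ 𝔇.ν) * (θΓ' * KCs' * KG' + KΓ * θC' * KG' + KΓ * K₀ * θΓ') ≤ θ
  /-- located input `hsmallKθ` (see the module docstring) -/
  hsmallKθ : K₀ * ((𝔇.𝒦 Z t).m * (1 + 2 / kap) ^ 𝔇.ν) * (θ * ((𝔇.𝒦 Z t).m * (1 + 2 / kap'') ^ 𝔇.ν)) < 1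
  /-- located input `hc0` (see the module docstring) -/
  hc0 : 0 ≤ cE
  /-- located input `hc` (see the module docstring) -/
  hc : ∀ i, (𝔇.𝒦 Z t).hC.1.eigenvalues i ≤ cE
  /-- located input `hαc` (see the module docstring) -/
  hαc : (2 * (θ * ((𝔇.𝒦 Z t).m * (1 + 2 / kap'') ^ 𝔇.ν)) + (γ₂ + a')) * cE ≤ 1 / 2
  /-- located input `hg` (see the module docstring) -/
  hg : 0 ≤ g
  /-- located input `hΓq` (see the module docstring) -/
  hΓq : ∀ X : (𝔇.𝒦 Z t).Λ ⊕ (𝔇.𝒦 Z t).C₀ → ℝ, ((𝔇.𝒦 Z t).Γ₀ *ᵥ X) ⬝ᵥ ((𝔇.𝒦 Z t).C *ᵥ ((𝔇.𝒦 Z t).Γ₀ *ᵥ X)) ≤ g * (X ⬝ᵥ X)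
  /-- located input `hsmall` (see the module docstring) -/
  hsmall : (2 * (θ * ((𝔇.𝒦 Z t).m * (1 + 2 / kap'') ^ 𝔇.ν)) + (γ₂ + a')) * (1 + 2 * cE * g) ≤ 1 / 2
  /-- located input `hPa` (see the module docstring) -/
  hPa : a ≤ γ₂ * rP ^ 2
  /-- located input `hvol` (see the module docstring) -/
  hvol : 2 * (K₀ * ((𝔇.𝒦 Z t).m * (1 + 2 / kap) ^ 𝔇.ν) * (θ * ((𝔇.𝒦 Z t).m * (1 + 2 / kap'') ^ 𝔇.ν)) * (1 + (1 - K₀ * ((𝔇.𝒦 Z t).m * (1 + 2 / kap) ^ 𝔇.ν) * (θ * ((𝔇.𝒦 Z t).m * (1 + 2 / kap'') ^ 𝔇.ν)))⁻¹) / 2) * (Fintype.card (𝔇.𝒦 Z t).Λ : ℝ) + w' + (2 * (θ * ((𝔇.𝒦 Z t).m * (1 + 2 / kap'') ^ 𝔇.ν)) + (γ₂ + a')) * cE * (Fintype.card (𝔇.𝒦 Z t).Λ : ℝ) + (2 * (θ * ((𝔇.𝒦 Z t).m * (1 + 2 / kap'') ^ 𝔇.ν)) + (γ₂ + a')) * (1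 + 2 * cE * g) * (Fintype.card ((𝔇.𝒦 Z t).Λ ⊕ (𝔇.𝒦 Z t).C₀) : ℝ) ≤ a₅ * ((Z.1).card : ℝ)
  /-- located input `hχe` (see the module docstring) -/
  hχe : ∀ B, χu Z t (s₀ • (-B)) = χu Z t (s₀ • B)
  /-- located input `hχce` (see the module docstring) -/
  hχce : ∀ B, χcu Z t (s₀ • (-B)) = χcu Z t (s₀ • B)
  /-- located input `hαc_c` (see the module docstring) -/
  hαc_c : (2 * (θ * ((𝔇.𝒦 Z t).m * (1 + 2 / kap'') ^ 𝔇.ν)) + (γ₂ + ac)) * cE ≤ 1 / 2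
  /-- located input `hsmall_c` (see the module docstring) -/
  hsmall_c : (2 * (θ * ((𝔇.𝒦 Z t).m * (1 + 2 / kap'') ^ 𝔇.ν)) + (γ₂ + ac)) * (1 + 2 * cE * g) ≤ 1 / 2
  /-- located input `hvol_c` (see the module docstring) -/
  hvol_c : 2 * (K₀ * ((𝔇.𝒦 Z t).m * (1 + 2 / kap) ^ 𝔇.ν) * (θ * ((𝔇.𝒦 Z t).m * (1 + 2 / kap'') ^ 𝔇.ν)) * (1 + (1 - K₀ * ((𝔇.𝒦 Z t).m * (1 + 2 / kap) ^ 𝔇.ν) * (θ * ((𝔇.𝒦 Z t).m * (1 + 2 / kap'') ^ 𝔇.ν)))⁻¹) / 2) * (Fintype.card (𝔇.𝒦 Z t).Λ : ℝ) + wc + (2 * (θ * ((𝔇.𝒦 Z t).m * (1 + 2 / kap'') ^ 𝔇.ν)) + (γ₂ + ac)) * cE * (Fintype.card (𝔇.𝒦 Z t).Λ : ℝ) + (2 * (θ * ((𝔇.𝒦 Z t).m * (1 + 2 / kap'') ^ 𝔇.ν)) + (γ₂ + ac)) * (1 + 2 * cE * g) * (Fintype.card ((𝔇.𝒦 Z t).Λ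 ⊕ (𝔇.𝒦 Z t).C₀) : ℝ) ≤ a₅ * ((Z.1).card : ℝ)
  /-- located input `hχ1` (see the module docstring) — SMALL-FIELD block: asked only on `P(t) = ∅` (№193; the box law is a small-field statement) -/
  hχ1 : t.2 = ∅ → ∀ B, χu Z t (s₀ • B) * χcu Z t (s₀ • B) ≤ 1
  /-- located input `hκ` (see the module docstring) -/
  hκ : 0 ≤ κ
  /-- located input `hboxR`: the BOX LAW of the unscaled-field boxes at `s₀` on `⟨B′,B′⟩ < Rb²` — SMALL-FIELD block: asked only on `P(t) = ∅` (№193; the box law is a small-field statement) -/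
  hboxR : t.2 = ∅ → ∀ B, B ⬝ᵥ B < Rb ^ 2 → χu Z t (s₀ • B) * χcu Z t (s₀ • B) = 1
  /-- located input `ha₀` (see the module docstring) -/
  ha₀ : 0 ≤ a₀
  /-- located input `hαc_b` (see the module docstring) -/
  hαc_b : (2 * (θ * ((𝔇.𝒦 Z t).m * (1 + 2 / kap'') ^ 𝔇.ν)) + (κ + a₀)) * cE ≤ 1 / 2
  /-- located input `hsmall_b` (see the module docstring) -/
  hsmall_b : (2 * (θ * ((𝔇.𝒦 Z t).m * (1 + 2 / kap'') ^ 𝔇.ν)) + (κ + a₀)) * (1 + 2 * cE * g) ≤ 1 / 2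
  /-- located input `hvol_b` (see the module docstring) -/
  hvol_b : 2 * (K₀ * ((𝔇.𝒦 Z t).m * (1 + 2 / kap) ^ 𝔇.ν) * (θ * ((𝔇.𝒦 Z t).m * (1 + 2 / kap'') ^ 𝔇.ν)) * (1 + (1 - K₀ * ((𝔇.𝒦 Z t).m * (1 + 2 / kap) ^ 𝔇.ν) * (θ * ((𝔇.𝒦 Z t).m * (1 + 2 / kap'') ^ 𝔇.ν)))⁻¹) / 2) * (Fintype.card (𝔇.𝒦 Z t).Λ : ℝ) + w₀ + (2 * (θ * ((𝔇.𝒦 Z t).m * (1 + 2 / kap'') ^ 𝔇.ν)) + (κ + a₀)) * cE * (Fintype.card (𝔇.𝒦 Z t).Λ : ℝ) + (2 * (θ * ((𝔇.𝒦 Z t).m * (1 + 2 / kap'') ^ 𝔇.ν)) + (κ + a₀)) * (1 + 2 * cE * g) * (Fintype.card ((𝔇.𝒦 Z t).Λ ⊕ (𝔇.𝒦 Z t).C₀) : ℝ) ≤ a₅ * ((Z.1).card : ℝ)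
  /-- located input `hα₀` (see the module docstring) -/
  hα₀ : 0 ≤ α₀
  /-- located input `hαc_f` (see the module docstring) -/
  hαc_f : (2 * (θ * ((𝔇.𝒦 Z t).m * (1 + 2 / kap'') ^ 𝔇.ν)) + α₀) * cE ≤ 1 / 2
  /-- located input `hsmall_f` (see the module docstring) -/
  hsmall_f : (2 * (θ * ((𝔇.𝒦 Z t).m * (1 + 2 / kap'') ^ 𝔇.ν)) + α₀) * (1 + 2 * cE * g) ≤ 1 / 2
  /-- located input `hr₁` (see the module docstring) — LARGE-FIELD block: asked only on `P(t) ≠ ∅` (№193; the (2.22) surplus at radius `r_P` over `r₁`) -/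
  hr₁ : t.2 ≠ ∅ → r₁ ^ 2 ≤ rP ^ 2
  /-- located input `hPa1` (see the module docstring) — LARGE-FIELD block: asked only on `P(t) ≠ ∅` (№193; the (2.22) surplus at radius `r_P` over `r₁`) -/
  hPa1 : t.2 ≠ ∅ → a ≤ γ₂ * r₁ ^ 2
  /-- located input `hA` (see the module docstring) — asked at EVERY configuration `ξ ∈ W` -/
  hA : ∀ ξ ∈ W, ∀ σ : TPt P.d (domCount P M (k + 1)) → ℂ, (∀ j, σ j ∈ Uσ) → ((𝔇.A Z t ξ σ).map Complex.re).PosDef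
  /-- located input `hθEle0` (see the module docstring) -/
  hθEle0 : θE ≤ θ
  /-- located input `hθΓle0` (see the module docstring) -/
  hθΓle0 : θΓ ≤ θ
  /-- located input `hθR1le0` (see the module docstring) -/
  hθR1le0 : ((𝔇.𝒦 Z t).m * (1 + 2 / (kap - kap')) ^ 𝔇.ν) * ((𝔇.𝒦 Z t).m * (1 + 2 / (kap' - kap'')) ^ 𝔇.ν) * (θΓ * KCs * KG + KΓ * θC * KG + KΓ * K₀ * θΓ) ≤ θ
  /-- located input `hαc_0` (see the module docstring) -/
  hαc_0 : (2 * (θ * ((𝔇.𝒦 Z t).m * (1 + 2 / kap'') ^ 𝔇.ν)) + (γ₂ + a₀)) * cE ≤ 1 / 2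
  /-- located input `hsmall_0` (see the module docstring) -/
  hsmall_0 : (2 * (θ * ((𝔇.𝒦 Z t).m * (1 + 2 / kap'') ^ 𝔇.ν)) + (γ₂ + a₀)) * (1 + 2 * cE * g) ≤ 1 / 2
  /-- located input `hvol_0` (see the module docstring) -/
  hvol_0 : 2 * (K₀ * ((𝔇.𝒦 Z t).m * (1 + 2 / kap) ^ 𝔇.ν) * (θ * ((𝔇.𝒦 Z t).m * (1 + 2 / kap'') ^ 𝔇.ν)) * (1 + (1 - K₀ * ((𝔇.𝒦 Z t).m * (1 + 2 / kap) ^ 𝔇.ν) * (θ * ((𝔇.𝒦 Z t).m * (1 + 2 / kap'') ^ 𝔇.ν)))⁻¹) / 2) * (Fintype.card (𝔇.𝒦 Z t).Λ : ℝ) + w₀ + (2 * (θ * ((𝔇.𝒦 Z t).m * (1 + 2 / kap'') ^ 𝔇.ν)) + (γ₂ + a₀)) * cE * (Fintype.card (𝔇.𝒦 Z t).Λ : ℝ) + (2 * (θ * ((𝔇.𝒦 Z t).m * (1 + 2 / kap'') ^ 𝔇.ν)) + (γ₂ + a₀)) * (1 + 2 * cE * g) * (Fintype.card ((𝔇.𝒦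 Z t).Λ ⊕ (𝔇.𝒦 Z t).C₀) : ℝ) ≤ a₅ * ((Z.1).card : ℝ)
  /-- located input `hRb`: the box-tail rate `e^{−½κRb²} ≤ T·s₀²` — SMALL-FIELD block: asked only on `P(t) = ∅` (№193; the box law is a small-field statement) -/
  hRb : t.2 = ∅ → Real.exp (-(κ / 2 * Rb ^ 2)) ≤ T * s₀ ^ 2
  /-- located input `hTP` (see the module docstring) — LARGE-FIELD block: asked only on `P(t) ≠ ∅` (№193; the (2.22) surplus at radius `r_P` over `r₁`) -/
  hTP : t.2 ≠ ∅ → Real.exp (-(γ₂ / 2 * (rP ^ 2 - r₁ ^ 2))) ≤ TP * s₀ ^ 2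
  /-- located input `hMvT` (see the module docstring) — SMALL-FIELD block: asked only on `P(t) = ∅` (№193; the box law is a small-field statement) -/
  hMvT : t.2 = ∅ → 1 + T ≤ Mv
  /-- located input `hMvP` (see the module docstring) — LARGE-FIELD block: asked only on `P(t) ≠ ∅` (№193; the (2.22) surplus at radius `r_P` over `r₁`) -/
  hMvP : t.2 ≠ ∅ → TP ≤ Mv
  -- ═════════ THE POTENTIALS OF THE UNSCALED-FIELD LAW: box radius, measurability and the primitive φ-law of the Wilson remainder, τ-radii, bond supports, cube-location, box-support law — then LEMMA 2's SENTENCE (below) in place of J12-D's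
  -- twenty-eight leading-part Taylor fields (`c₀ … c₂`, their signs, `𝒲₃ h𝒲₃m h𝒲₃ h1 h1loc h2 h3`, `D𝒪 hD𝒪m hD𝒪 h0 h4 h5 h6`, `hloc𝒲`), which module J17-M DERIVES at each configuration; the older-terms laws for EVERY ADMISSIBLE
  -- history `old ∈ W1.AdmHist (W1.spaceOfRecord Sg Rz α₀ α₁) E₀ κE k` = (1.18)`(E₀, κE)` on the space tables of record ∧ analytic there, [I] p. 263; lens T32 ∕ (R-a)) ═════════
  /-- located letter `ρ`: the radius of the sup-ball of the unscaled field ([II] (1.34), print's ε₁; coupling-free) -/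
  ρ : ℝ
  /-- located input `hρ` -/
  hρ : 0 < ρ
  /-- located input `h𝒲m`: measurability of the Wilson remainder in the unscaled row-bond field — asked at EVERY configuration `ξ ∈ W` -/
  h𝒲m : ∀ ξ ∈ W, ∀ Y : TDom P.d (L * domCount P M (k + 1)), Measurable (𝒲 Z t ξ Y)
  /-- located input `h𝒲d` — PRIMITIVE φ-LAW of the Wilson remainder ([I] (2.9)–(2.11): an analytic function of the configuration): at each `(Y, A)`, `ξ ↦ 𝒲(ξ; Y, A)` is complex differentiable on `W` -/
  h𝒲d : ∀ (Y : TDom P.d (L * domCount P M (k + 1))) (A : ((𝔇.𝒦 Z t).Λ → ℝ)), DifferentiableOn ℂ (fun ξ : CPair P 𝔸 => 𝒲 Z t ξ Y A) W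
  /-- located letter `R`: the τ-radii bounds of the per-domain regions `Uτ Y` -/
  R : TDom P.d (L * domCount P M (k + 1)) → ℝ
  /-- located input `hR` -/
  hR : ∀ Y ∈ t.1, 0 ≤ R Y
  /-- located input `hUτR`: the τ-regions lie in the discs of radii `R Y` -/
  hUτR : ∀ Y ∈ t.1, ∀ z ∈ Uτ Y, ‖z‖ ≤ R Y
  /-- located letter `S`: the bond supports of the Wilson remainder per domain -/
  S : TDom P.d (L * domCount P M (k + 1)) → Finset (𝔇.𝒦 Z t).Λ
  /-- located letter `cubeOf`: the cube-location of the row bonds ((G)) -/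
  cubeOf : (𝔇.𝒦 Z t).Λ → TPt P.d (L * domCount P M (k + 1))
  /-- located input `hS`: the supports `S Y` lie in `Y` -/
  hS : ∀ Y ∈ t.1, ∀ b ∈ S Y, cubeOf b ∈ Y.1
  /-- located letter `Cp`: the (2.19) profile constant of the rate weight `R(Y)c₃(Y)` -/
  Cp : ℝ
  /-- located letter `κp`: the (2.19) profile rate -/
  κp : ℝ
  /-- located input `hCp` -/
  hCp : 0 ≤ Cp
  /-- located input `hκp`: the profile rate is above the (1.26) threshold -/
  hκp : kappa₀ (4 * 2 ^ P.d) (2 * P.d) ≤ κp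
  /-- located letter `S₀`: the box-support coordinate set ((2.2)–(2.3), [I] (2.9)) -/
  S₀ : Set (𝔇.𝒦 Z t).Λ
  /-- located input `hbox`: the s-FREE BOX-SUPPORT LAW of `χᵘ` on the unscaled field -/
  hbox : ∀ A : ((𝔇.𝒦 Z t).Λ → ℝ), χu Z t A ≠ 0 → ∀ b ∈ S₀, |A b| ≤ ρ
  /-- located input `hSS₀` ((2.2)–(2.3) p. 12: the bonds of `Y ∈ 𝐃` lie in `Y₀ = ⋃ 𝐃`): the bond supports `S Y` of the potentials lie in the box-support set `S₀` -/
  hSS₀ : ∀ Y ∈ t.1, ∀ b ∈ S Y, b ∈ S₀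
  -- ═════════ [II] LEMMA 2's SENTENCE PER CONFIGURATION OF THE THICKENING (node00-def-W1 W1-12b `TermDatum214.Lemma2Inputs` vocabulary; ONE radius, per-domain sup bounds UNIFORM on `W` and on the admissible
  -- class — print's constants depend on (d, L, M, α′₀, α′₁) only; the LEADING PARTS `cubicPart (Wc Z t ξ Y)`, `linPart (Oc Z t old ξ Y)` then VARY WITH THE CONFIGURATION `ξ`, as [I] (2.8) ∕ [II] (1.41) have it) ═════════
  /-- located datum `Wc`: the Wilson remainder READ IN THE COMPLEXIFIED unscaled row-bond field, PER CONFIGURATION ([II] Lemma 2 p. 11: «an analytic function … of B′ in the domain {B′ : e^{16κ₁}|B′| ≤ a₁ on Y}»; [I] (2.8) p. 266: `V(H₁B′)` with `H₁ = H_{1,k}(U_k)` — CONFIGURATION-DEPENDENT; W1-12b `TermDatum214.ComplexWilson`) -/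
  Wc : 𝔇.ComplexWilson
  /-- located datum `Oc`: the older-terms potential READ IN THE COMPLEXIFIED unscaled field, PER ADMISSIBLE HISTORY AND CONFIGURATION ([II] (1.34)–(1.36) p. 9, (1.41)–(1.42) p. 11: `𝐕″_k` reads the older terms `E^{(j)}` at `U(φ)`; W1-12b `TermDatum214.ComplexOlder`) -/
  Oc : 𝔇.ComplexOlder
  /-- located letter `RA`: the ONE radius of analyticity of both potentials in the sup norm of the complexified unscaled field (print's `a₁e^{−16κ₁}`; `Y`-free, configuration-free) -/
  RA : ℝ
  /-- located input `hρRA`: the box radius `ρ` (print's `ε₁`, [I] (2.9)) lies INSIDE the analyticity ball -/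
  hρRA : ρ < RA
  /-- located letter `M𝒲`: the per-domain sup bound of the complex Wilson remainder on the ball ((1.39) p. 10; UNIFORM in the configuration `ξ ∈ W`) -/
  M𝒲 : TDom P.d (L * domCount P M (k + 1)) → ℝ
  /-- located letter `M𝒪`: the per-domain sup bound of the complex older-terms potential on the ball ((1.36) p. 9; UNIFORM in `ξ ∈ W` AND in the admissible history — (1.18)'s letters are) -/
  M𝒪 : TDom P.d (L * domCount P M (k + 1)) → ℝ
  /-- located input `hM𝒲`: the Wilson sup bounds are nonnegative on `𝐃` (automatic when `W ≠ ∅`; displayed so that the derived letters are signed on an empty thickening too) -/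
  hM𝒲 : ∀ Y ∈ t.1, 0 ≤ M𝒲 Y
  /-- located input `hM𝒪`: the older-terms sup bounds are nonnegative on `𝐃` -/
  hM𝒪 : ∀ Y ∈ t.1, 0 ≤ M𝒪 Y
  /-- located input `h𝒲re` — the REAL-SLICE identity of the Wilson remainder at EVERY configuration `ξ ∈ W`: `𝒲(ξ; Y, A) = 𝒲ᶜ(ξ; Y, A ↪ ℂ)` (W1-12b `Lemma2Inputs.h𝒲re` per ξ) -/
  h𝒲re : ∀ ξ ∈ W, ∀ (Y : TDom P.d (L * domCount P M (k + 1))) (A : ((𝔇.𝒦 Z t).Λ → ℝ)), 𝒲 Z t ξ Y A = Wc Z t ξ Y (ofRealVec A)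
  /-- located input `hWd` — Lemma 2's ANALYTICITY of the Wilson remainder in the complexified field on the sup-ball, at EVERY `ξ ∈ W` -/
  hWd : ∀ ξ ∈ W, ∀ Y : TDom P.d (L * domCount P M (k + 1)), DifferentiableOn ℂ (Wc Z t ξ Y) (ball 0 RA)
  /-- located input `hWM` — the SUP BOUND (1.39) of the complex Wilson remainder on the ball, at EVERY `ξ ∈ W`, with the ξ-UNIFORM letter `M𝒲(Y)` -/
  hWM : ∀ ξ ∈ W, ∀ Y : TDom P.d (L * domCount P M (k + 1)), ∀ z ∈ ball (0 : ((𝔇.𝒦 Z t).Λ → ℂ)) RA, ‖Wc Z t ξ Y z‖ ≤ M𝒲 Y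
  /-- located input `hWB` — the THIRD-ORDER ONSET of the Wilson remainder ([I] (2.8) p. 266 «terms of at least third order in H₁B′»), at EVERY `ξ ∈ W` (a producer obtains it by `B13Lemma2LeadingParts.beginsAt_three`) -/
  hWB : ∀ ξ ∈ W, ∀ Y : TDom P.d (L * domCount P M (k + 1)), BeginsAt (Wc Z t ξ Y) 3
  /-- located input `hlocY𝒲` — `Y`-LOCALITY of the Wilson remainder through the bond supports `S Y` ((1.34) p. 9 «restricted to the interior of Y»), at EVERY `ξ ∈ W` -/
  hlocY𝒲 : ∀ ξ ∈ W, ∀ Y ∈ t.1, ∀ A A' : ((𝔇.𝒦 Z t).Λ → ℝ), (∀ b ∈ S Y, A b = A' b) → 𝒲 Z t ξ Y A = 𝒲 Z t ξ Y A'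
  /-- located input `h𝒪re` — the REAL-SLICE identity of the older-terms potential, EVERY ADMISSIBLE history and EVERY `ξ ∈ W`: `𝒪(old, ξ; Y, A) = 𝒪ᶜ(old, ξ; Y, A ↪ ℂ)` -/
  h𝒪re : ∀ old : OlderTerms P 𝔸 M k, old ∈ AdmHist (spaceOfRecord (M := M) Sg Rz (fun _ => cs.α₀) (fun _ => cs.α₁)) E₀ κE k → ∀ ξ ∈ W, ∀ (Y : TDom P.d (L * domCount P M (k + 1))) (A : ((𝔇.𝒦 Z t).Λ → ℝ)), 𝒪 Z t old ξ Y A = Oc Z t old ξ Y (ofRealVec A)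
  /-- located input `hOd` — Lemma 2's ANALYTICITY of the older-terms potential in the complexified field on the sup-ball ((1.34): «defined and analytic on … × {B : |B| < ε₁g_k⁻¹ on Y}»), every admissible history, EVERY `ξ ∈ W` -/
  hOd : ∀ old : OlderTerms P 𝔸 M k, old ∈ AdmHist (spaceOfRecord (M := M) Sg Rz (fun _ => cs.α₀) (fun _ => cs.α₁)) E₀ κE k → ∀ ξ ∈ W, ∀ Y : TDom P.d (L * domCount P M (k + 1)), DifferentiableOn ℂ (Oc Z t old ξ Y) (ball 0 RA)
  /-- located input `hOM` — the SUP BOUND (1.36) of the complex older-terms potential on the ball, every admissible history, EVERY `ξ ∈ W`, with the UNIFORM letter `M𝒪(Y)` -/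
  hOM : ∀ old : OlderTerms P 𝔸 M k, old ∈ AdmHist (spaceOfRecord (M := M) Sg Rz (fun _ => cs.α₀) (fun _ => cs.α₁)) E₀ κE k → ∀ ξ ∈ W, ∀ Y : TDom P.d (L * domCount P M (k + 1)), ∀ z ∈ ball (0 : ((𝔇.𝒦 Z t).Λ → ℂ)) RA, ‖Oc Z t old ξ Y z‖ ≤ M𝒪 Y
  /-- located input `hdecay`: the (2.19) PROFILE of the rate weight ((P)), at the derived cubic letter `c₃(Y) = M𝒲(Y)∕RA³`: `R(Y)·(M𝒲(Y)∕RA³) ≤ C_p·e^{−κ_p d(Y)}` -/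
  hdecay : ∀ Y ∈ t.1, R Y * (M𝒲 Y / RA ^ 3) ≤ Cp * Real.exp (-κp * (tsys P.d (L * domCount P M (k + 1))).dj Y)
  /-- located letter `δ`: the centred rate split -/
  δ : ℝ
  /-- located input `hδ` -/
  hδ : 0 < δ
  /-- located input `h𝒪m`: measurability of the older-terms potential, EVERY ADMISSIBLE history — asked at EVERY configuration `ξ ∈ W` -/
  h𝒪m : ∀ old : OlderTerms P 𝔸 M k, old ∈ AdmHist (spaceOfRecord (M := M) Sg Rz (fun _ => cs.α₀) (fun _ => cs.α₁)) E₀ κE k → ∀ ξ ∈ W, ∀ Y : TDom P.d (L * domCount P M (k + 1)), Measurable (𝒪 Z t old ξ Y)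
  /-- located input `h𝒪d` — PRIMITIVE φ-LAW of the older-terms potential ((1.41) p. 11: a finite linear reading of the older terms at configurations moving analytically with `ξ`; [I] p. 263: the older terms are analytic on their spaces — whence asked for every ADMISSIBLE history only): at each `(Y, A)`, `ξ ↦ 𝒪(old, ξ; Y, A)` is complex differentiable on `W` -/
  h𝒪d : ∀ old : OlderTerms P 𝔸 M k, old ∈ AdmHist (spaceOfRecord (M := M) Sg Rz (fun _ => cs.α₀) (fun _ => cs.α₁)) E₀ κE k → ∀ (Y : TDom P.d (L * domCount P M (k + 1))) (A : ((𝔇.𝒦 Z t).Λ → ℝ)), DifferentiableOn ℂ (fun ξ : CPair P 𝔸 => 𝒪 Z t old ξ Y A) W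
  /-- located input `hloc𝒪`: the `Y`-locality of the older-terms potential in `S₀`, every admissible history — asked at EVERY configuration `ξ ∈ W` -/
  hloc𝒪 : ∀ old : OlderTerms P 𝔸 M k, old ∈ AdmHist (spaceOfRecord (M := M) Sg Rz (fun _ => cs.α₀) (fun _ => cs.α₁)) E₀ κE k → ∀ ξ ∈ W, ∀ Y ∈ t.1, ∀ A A' : ((𝔇.𝒦 Z t).Λ → ℝ), (∀ b ∈ S₀, A b = A' b) → 𝒪 Z t old ξ Y A = 𝒪 Z t old ξ Y A'
  /-- located input `hOhol`: holomorphy of the older-terms potential along every holomorphic (1.18)-bounded older-term curve whose values are ANALYTIC ON THE TABLES (the history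
  direction of Lemma 2's potentials — a producer's law, displayed) — asked at EVERY configuration `ξ ∈ W` -/
  hOhol : ∀ ξ ∈ W, ∀ (O : Set ℂ), IsOpen O → ∀ cv : ℂ → OlderTerms P 𝔸 M k,
    (∀ (j : Fin (k + 1)) (Y : (domSys P M j).Dom) (ψ : CPair P 𝔸), ψ ∈ spaceI Sg Rz M j (domSites P M j Y) cs.α₀ cs.α₁ →
      DifferentiableOn ℂ (fun z => cv z j Y ψ) O ∧ ∀ z ∈ O, ‖cv z j Y ψ‖ ≤ E₀ * Real.exp (-(κE * torusTreeLen Y.1))) →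
    (∀ z ∈ O, ∀ (j : Fin (k + 1)) (Y : (domSys P M j).Dom), AnalyticOnNhd ℂ (cv z j Y) (spaceI Sg Rz M j (domSites P M j Y) cs.α₀ cs.α₁)) →
    ∀ (Y : TDom P.d (L * domCount P M (k + 1))) (A : ((𝔇.𝒦 Z t).Λ → ℝ)), DifferentiableOn ℂ (fun z => 𝒪 Z t (cv z) ξ Y A) O
  -- ═════════ THE CLOSURES (slice letters `a′ w′ a_c w_c w₀` against the local growth constants; `m₃ := C_p·K₀(4·2^d, 2d)` spelled out, `B12TreeDecay.K₀` qualified against the kernel letter `K₀` of this record) ═════════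
  /-- located input `ha'`: the uncentred quadratic rate `(1+ρ_b)²·(2ρm₃) ≤ a′` -/
  ha' : (1 + ρb) ^ 2 * (2 * ρ * (Cp * B12TreeDecay.K₀ (4 * 2 ^ P.d) (2 * P.d))) ≤ a'
  /-- located input `hw'`: the uncentred additive constant `(1+ρ_b)²·Σ R(c₀ + c₁ρ) ≤ w′` at the derived letters `c₀ = M𝒪`, `c₁ = 2M𝒪∕RA` -/
  hw' : (1 + ρb) ^ 2 * (∑ Y ∈ t.1, R Y * (M𝒪 Y + (2 * M𝒪 Y / RA) * ρ)) ≤ w'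
  /-- located input `hac`: the centred quadratic rate `2δ + 8ρm₃ ≤ a_c` -/
  hac : 2 * δ + 8 * ρ * (Cp * B12TreeDecay.K₀ (4 * 2 ^ P.d) (2 * P.d)) ≤ ac
  /-- located input `hwc`: the centred additive constant (dag-n10-c module 46 §4∕§5's closure inequality, verbatim shape) at the derived letters `c₃ = c₃′ = M𝒲∕RA³`, `c₄ = 2M𝒲∕RA⁴`, `c₀ = M𝒪`, `c₁ = c₁′ = 2M𝒪∕RA`, `c₂ = 4M𝒪∕RA²` -/
  hwc : Real.exp (∑ Y ∈ t.1, R Y * M𝒪 Y) * ((∑ Y ∈ t.1, R Y * ((4 * (2 * M𝒲 Y / RA ^ 4) + (4 * (M𝒲 Y / RA ^ 3) + 4 * (M𝒲 Y / RA ^ 3)) / ρ) * (4 / (Real.exp 1 * δ)) ^ 4 +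
      ((4 * M𝒪 Y / RA ^ 2) + ((2 * M𝒪 Y / RA) + (2 * M𝒪 Y / RA)) / ρ) * (2 / (Real.exp 1 * δ)) ^ 2)) * Real.exp (δ / 2) +
      ((∑ Y ∈ t.1, R Y * (4 * (M𝒲 Y / RA ^ 3) * (3 / (Real.exp 1 * δ)) ^ 3 + (2 * M𝒪 Y / RA) * (1 / (Real.exp 1 * δ)))) * Real.exp (δ / 2)) ^ 2 *
      Real.exp ((∑ Y ∈ t.1, R Y * (M𝒪 Y + (2 * M𝒪 Y / RA) * ρ)) + ∑ Y ∈ t.1, R Y * M𝒪 Y)) ≤ Real.exp wc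
  /-- located input `hw₀`: the centre's additive constant `Σ R(Y)M𝒪(Y) ≤ w₀` (the box tail's and the box-free centre's `Σ|τ||𝒪(·,0)| ≤ w₀`, at `c₀ = M𝒪`) -/
  hw₀ : ∑ Y ∈ t.1, R Y * M𝒪 Y ≤ w₀

end YMDAG.N22.W1

end
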